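import Literature.AlgebraicGeometry.Motives.HodgeThetaSubalgebraUnitaryTransfer
import HarnessLib

/-!
# The unitary `Θ`-subalgebra programme — the restriction to `W = ker(φ_ℂ − μ)` is a Lie algebra ISOMORPHISM onto its image,
# and transports the Killing form (Ribet 1983 Thm. 3 / Moonen–Zarhin 1999 (2.3): `𝔲_K(V,ψ)_ℂ ≅ 𝔤𝔩(W)` by restriction;
# Deligne LNM 900 I §3)

Topic `Literature/AlgebraicGeometry/Motives` (namespace `Literature.AlgebraicGeometry.Motives.HodgeStructure`).  Theorems only
(no definition, no named fact; D-0026).  Written for the cell `pub-hodgeav-hg6` (req-37 (A) row 2, TABLE X row 8-`(4,2)`; brick U1d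
of the `(4,2)` programme — the last socket item named in `HodgeThetaSubalgebraUnitaryTransfer`; honest framing of that cell: HC /
HC_AV / HC_CM / H2 NOT proved — THIS file is unconditional linear algebra and discharges no hypothesis of the cell's cover).

SETTING (as in `HodgeThetaSubalgebraUnitary`): `H` polarized of weight `1`, `φ ∈ End_Hdg(V)` with `φ² = −d` (`d > 0`),
`End_Hdg(V) = ℚ + ℚφ`, `μ² = −d`, `W = ker(φ_ℂ − μ)`.  Gordon's survey (proof of 6.3.3) and Moonen–Zarhin (2.3) identify
`𝔲_K(V,ψ) ⊗ ℂ` with `𝔤𝔩(W)` by RESTRICTION to `W` (an operator commuting with `φ_ℂ` preserves `W`, and a `ψ_ℂ`-skew such operator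
is determined by its restriction, `W′ = conj W` being the `ψ_ℂ`-dual of `W`: `UnitaryTheta.eq_zero_of_forall_mem_eigenspace`).

* **`UnitaryTheta.exists_restrict_lieEquiv`** — for any complex Lie subalgebra `𝔏 ⊆ End(V_ℂ)` of `φ_ℂ`-commuting `ψ_ℂ`-skew
  operators (e.g. `spanC 𝔤`, `spanC 𝔡(𝔤)` for an admissible `𝔤`): there are a Lie subalgebra `𝔏_W ⊆ End(W)` and a Lie algebra
  ISOMORPHISM `e : 𝔏 ≃ₗ⁅ℂ⁆ 𝔏_W` with `e X = X|_W`, `𝔏_W = {X|_W : X ∈ 𝔏}`, and — Mathlib's `LieAlgebra.killingForm_of_equiv_apply` —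
  **`κ_{𝔏_W}(X|_W, Y|_W) = κ_𝔏(X, Y)`**.
With `UnitaryTheta.trace_mul_eq_two_mul_trace_restrict` (`tr_V = 2·tr_W`) and `killingForm_spanC_baseChange_mem_range` (κ rational
on rational pairs) of `…UnitaryTransfer`, a complex core working in `End(W)` with the form `tr_W − c·κ_{𝔏_W}` on the restricted
derived algebra reports, through `e`, on the RATIONAL form `½tr_V − c·κ` on `spanC 𝔡(𝔤)` — the input of the radical kill
(`HodgeThetaSubalgebraRadicalKill`).  This closes the socket of the `(4,2)` programme; the complex core U2 remains.

## References

* [Ribet1983] K. A. Ribet, *Hodge classes on certain types of abelian varieties*, Amer. J. Math. 105 (1983), Thm. 3.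
* [Gordon1997] B. B. Gordon, *A survey of the Hodge conjecture for abelian varieties*, §6 (proof of Thm. 6.3.3, pp. 18–19).
* [MoonenZarhin1999LowDim] B. Moonen, Yu. Zarhin, Math. Ann. 315 (1999), §2 (2.3).
* [Deligne1982HodgeCycles] P. Deligne, *Hodge cycles on abelian varieties*, LNM 900 (1982), I §3 Prop. 3.4, 3.6.
-/

noncomputable section

open scoped TensorProduct

namespace Literature.AlgebraicGeometry.Motives

namespace HodgeStructure

universe u

variable {V : Type u} [AddCommGroup V] [Module ℚ V] {n : ℤ}

set_option maxHeartbeats 800000 in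
/-- **Restriction to `W` is a Lie algebra isomorphism onto its image and transports the Killing form.**  For a complex Lie
subalgebra `𝔏 ⊆ End(V_ℂ)` whose elements commute with `φ_ℂ` and are `ψ_ℂ`-skew: a Lie subalgebra `𝔏_W ⊆ End(W)`, `W = ker(φ_ℂ − μ)`,
and `e : 𝔏 ≃ₗ⁅ℂ⁆ 𝔏_W` with `(e X) w = X w`, `𝔏_W = {F | ∃ X ∈ 𝔏, F = X|_W}`, `κ_{𝔏_W}(e X, e Y) = κ_𝔏(X, Y)`.  Injectivity is
determination on `W` (`UnitaryTheta.eq_zero_of_forall_mem_eigenspace`); the Killing clause is `LieAlgebra.killingForm_of_equiv_apply`.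
[cite: Gordon1997, §6 (pp. 18–19)] [cite: MoonenZarhin1999LowDim, §2 (2.3)] [cite: Deligne1982HodgeCycles, I §3 Prop. 3.4] -/
theorem UnitaryTheta.exists_restrict_lieEquiv [Module.Finite ℚ V] [Nontrivial V] (H : HodgeStructure V n)
    (ψ : H.Polarization) {φ : Module.End ℚ V} (hφE : φ ∈ H.endAlg) {d : ℚ} (hd : 0 < d) (hφ2 : φ * φ = -(d • 1))
    (hE : ∀ a ∈ H.endAlg, ∃ x y : ℚ, a = x • 1 + y • φ) {μ : ℂ} (hμ : μ ^ 2 = -(d : ℂ)) :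
    letI : LieRing (Module.End ℂ (ℂ ⊗[ℚ] V)) := LieRing.ofAssociativeRing
    letI : LieRing (Module.End ℂ ↥(Module.End.eigenspace (φ.baseChange ℂ) μ)) := LieRing.ofAssociativeRing
    ∀ (𝔏 : LieSubalgebra ℂ (Module.End ℂ (ℂ ⊗[ℚ] V))),
      (∀ X ∈ 𝔏, X * φ.baseChange ℂ = φ.baseChange ℂ * X) →
      (∀ X ∈ 𝔏, ∀ x y, ψ.form.baseChange ℂ (X x) y + ψ.form.baseChange ℂ x (X y) = 0) →
      ∃ (𝔏W : LieSubalgebra ℂ (Module.End ℂ ↥(Module.End.eigenspace (φ.baseChange ℂ) μ)))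
        (e : 𝔏 ≃ₗ⁅ℂ⁆ 𝔏W),
        (∀ (X : 𝔏) (w : ↥(Module.End.eigenspace (φ.baseChange ℂ) μ)),
          (((e X : 𝔏W) : Module.End ℂ ↥(Module.End.eigenspace (φ.baseChange ℂ) μ)) w : ℂ ⊗[ℚ] V) =
            (X : Module.End ℂ (ℂ ⊗[ℚ] V)) w) ∧
        (∀ F : Module.End ℂ ↥(Module.End.eigenspace (φ.baseChange ℂ) μ),
          F ∈ 𝔏W ↔ ∃ X ∈ 𝔏, ∀ w : ↥(Module.End.eigenspace (φ.baseChange ℂ) μ),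
            (F w : ℂ ⊗[ℚ] V) = (X : Module.End ℂ (ℂ ⊗[ℚ] V)) w) ∧
        (∀ X Y : 𝔏, killingForm ℂ 𝔏W (e X) (e Y) = killingForm ℂ 𝔏 X Y) := by
  letI iV : LieRing (Module.End ℂ (ℂ ⊗[ℚ] V)) := LieRing.ofAssociativeRing
  letI iW : LieRing (Module.End ℂ ↥(Module.End.eigenspace (φ.baseChange ℂ) μ)) := LieRing.ofAssociativeRing
  intro 𝔏 hφ hskew
  have hmem : ∀ X ∈ 𝔏, ∀ w ∈ (Module.End.eigenspace (φ.baseChange ℂ) μ), X w ∈ (Module.End.eigenspace (φ.baseChange ℂ) μ) :=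
    fun X hX w hw => UnitaryTheta.apply_mem_eigenspace_of_commute (hφ X hX) hw
  -- the restriction as a linear map
  let ρ₀ : 𝔏 →ₗ[ℂ] Module.End ℂ (Module.End.eigenspace (φ.baseChange ℂ) μ) :=
    { toFun := fun X => (X : Module.End ℂ (ℂ ⊗[ℚ] V)).restrict (hmem X X.2)
      map_add' := fun X Y => LinearMap.ext fun w => Subtype.ext rfl
      map_smul' := fun c X => LinearMap.ext fun w => Subtype.ext rfl }
  have hρ₀ : ∀ (X : 𝔏) (w : (Module.End.eigenspace (φ.baseChange ℂ) μ)),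
      ((ρ₀ X) w : ℂ ⊗[ℚ] V) = (X : Module.End ℂ (ℂ ⊗[ℚ] V)) w := fun X w => rfl
  -- it is a Lie homomorphism
  let ρ : 𝔏 →ₗ⁅ℂ⁆ Module.End ℂ (Module.End.eigenspace (φ.baseChange ℂ) μ) :=
    { ρ₀ with
      map_lie' := by
        intro X Y
        refine LinearMap.ext fun w => Subtype.ext ?_
        change ((ρ₀ ⁅X, Y⁆) w : ℂ ⊗[ℚ] V) = ((ρ₀ X * ρ₀ Y - ρ₀ Y * ρ₀ X) w : ℂ ⊗[ℚ] V)
        rw [hρ₀, LieSubalgebra.coe_bracket, LieRing.of_associative_ring_bracket, LinearMap.sub_apply,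
          Module.End.mul_apply, Module.End.mul_apply, LinearMap.sub_apply, Submodule.coe_sub, Module.End.mul_apply,
          Module.End.mul_apply, hρ₀, hρ₀, hρ₀, hρ₀] }
  have hρ : ∀ (X : 𝔏) (w : (Module.End.eigenspace (φ.baseChange ℂ) μ)),
      ((ρ X) w : ℂ ⊗[ℚ] V) = (X : Module.End ℂ (ℂ ⊗[ℚ] V)) w := fun X w => rfl
  -- injectivity: determination on `(Module.End.eigenspace (φ.baseChange ℂ) μ)`
  have hinj : Function.Injective ρ := by
    intro X Y hXY
    apply Subtype.ext
    have h0 := UnitaryTheta.eq_zero_of_forall_mem_eigenspace H ψ hφE hd hφ2 hE hμ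
      (D := (X : Module.End ℂ (ℂ ⊗[ℚ] V)) - (Y : Module.End ℂ (ℂ ⊗[ℚ] V)))
      (by rw [sub_mul, mul_sub, hφ _ X.2, hφ _ Y.2])
      (fun x y => by
        have h1 := hskew _ X.2 x y
        have h2 := hskew _ Y.2 x y
        rw [LinearMap.sub_apply, LinearMap.sub_apply, map_sub, LinearMap.sub_apply, map_sub]
        linear_combination h1 - h2)
      (fun w hw => by
        have h := congrArg (fun F : Module.End ℂ (Module.End.eigenspace (φ.baseChange ℂ) μ) =>
          ((F ⟨w, hw⟩ : (Module.End.eigenspace (φ.baseChange ℂ) μ)) : ℂ ⊗[ℚ] V)) hXY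
        simp only [hρ] at h
        rw [LinearMap.sub_apply, h, sub_self])
    exact sub_eq_zero.1 h0
  refine ⟨ρ.range, LieEquiv.ofInjective ρ hinj, fun X w => ?_, fun F => ?_, fun X Y => ?_⟩
  · rw [LieEquiv.ofInjective_apply, hρ]
  · rw [LieHom.mem_range]
    constructor
    · rintro ⟨X, rfl⟩
      exact ⟨X, X.2, fun w => hρ X w⟩
    · rintro ⟨X, hX, hF⟩
      exact ⟨⟨X, hX⟩, LinearMap.ext fun w => Subtype.ext ((hρ ⟨X, hX⟩ w).trans (hF w).symm)⟩
  · exact LieAlgebra.killingForm_of_equiv_apply (LieEquiv.ofInjective ρ hinj) X Y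

end HodgeStructure

end Literature.AlgebraicGeometry.Motives

end
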